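/-
Copyright (c) 2026. All rights reserved.
Released under Apache 2.0 license as described in the file LICENSE.
Authors: HodgeCM publication cell (pub-hodgecm), GR lane, seat GR-1 (`pub-hodgecm-own-real34`), on GR-2's `GRConstructionGen` chain.
-/
import Literature.NumberTheory.GelbartRogawski1991.CompatibleSplittingQuadraticDoublingGen
import Literature.NumberTheory.GelbartRogawski1991.DoubledWeilRepresentationLocalFamilyGen
import Literature.NumberTheory.GelbartRogawski1991.Prop311AsPrintedOfRecord
import HarnessLib

/-!
# [GelbartRogawski1991, Proposition 3.1.1] AS PRINTED (every quadratic `E/F`) FROM THE GENERAL ARCHIMEDEAN HALF ALONE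

Topic `NumberTheory/GelbartRogawski1991`; namespaces `Literature.NumberTheory.GelbartRogawski1991.GRConstructionGen` and
`….Prop311`.  Theorems only; no definition, no named fact, no `sorry`, no instance attribute.

State of the general-`(F, E, σ)` programme for `Prop311AsPrinted` (the statement-exact typing of [GR91 Prop. 3.1.1], quantified over
EVERY quadratic extension of number fields) after GR-2 g125 (`GRConstructionGen`: the whole doubling chain re-typed to the telescope
`(F E c hcδ hδ hd e TV hV hVd TW hW hWd)`, closing file `CompatibleSplittingQuadraticDoublingGen.compatibleSplitting_of_inputs χ hfin ha`)
and GR-1 g93 (`QuadraticHeckeCharacterQuadExt`, `GlobalSplittingCharactersQuadExt`, `QuadExtSplittingCharLocalComponents`,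
`LocalDoubledUnitarySplittingDataQuadExt`, `DoubledWeilRepresentationLocalFamilyGen` = the finite half; `Prop311AsPrintedOfRecord` = the
END reduced to the record `Prop311.SymmetricCompatibleSplitting`):

* the splitting character exists for every quadratic `E/F` (`exists_isUnitary_isSplittingCharExt_one`);
* the finite half exists for every Haar data (`GRConstructionGen.nonempty_finLocalFamily`);
* so the ONLY remaining input of the general doubling construction is the ARCHIMEDEAN HALF — a continuous homomorphic section
  `sa : H(F ⊗ ℝ) →* Mp(𝕎^𝔻)ᶜᵒⁿᵗ` of the doubled unitary group over the archimedean places with archimedean operators and the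
  `P_Δ`-prescription (`GRConstructionGen.IsArchHalf … χ sa`); at CM data it is the tree theorem `GRConstruction.exists_isArchHalf`
  (every infinite place of `L⁺` real with `L_w = ℂ`), in general it needs the three archimedean place types (real inert ∕ real split ∕
  complex) — programme part §3.C.

THIS FILE composes everything else:

* **`GRConstructionGen.symmetricCompatibleSplitting_of_archHalf`** — the general archimedean half (for every datum and every unitary
  splitting character) ⇒ `Prop311.SymmetricCompatibleSplitting` (the general `gru_shape`): choose `χ` by
  `exists_isUnitary_isSplittingCharExt_one`, feed `nonempty_finLocalFamily` and the hypothesis into `compatibleSplitting_of_inputs`;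
* **`Prop311.prop311AsPrinted_of_archHalf`** — the general archimedean half ⇒ `Prop311AsPrinted`
  (`prop311AsPrinted_of_symmetricCompatibleSplitting`).

So `theorem prop311AsPrinted_holds : Prop311AsPrinted := prop311AsPrinted_of_archHalf exists_isArchHalf_gen` once the general
archimedean half `exists_isArchHalf_gen` is proved.  Nothing in this file is a claim of the manuscripts adjudicated by the Hodge-CM cell;
`Prop311AsPrinted` is NOT inhabited here (conditional); HC_CM is not touched.

## References
* [GelbartRogawski1991] S. Gelbart, J. Rogawski, Invent. Math. 105 (1991) 445–472, §3.1 Proposition 3.1.1 p. 455 L1–3, §3.2 p. 457.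
* [Kudla1994] S. Kudla, Israel J. Math. 87 (1994), §3 Thm. 3.1.
-/

set_option autoImplicit false

noncomputable section

open scoped Classical
open scoped Matrix Kronecker TensorProduct
open NumberField IsDedekindDomain
open Literature.RepresentationTheory.HeisenbergGroup
open Literature.NumberTheory.Automorphic
open Literature.NumberTheory.Weil1964
open Literature.NumberTheory.GaloisRepresentations
open Literature.RepresentationTheory.HarrisKudlaSweet1996

namespace Literature.NumberTheory.GelbartRogawski1991

namespace GRConstructionGen

open UnitaryDualPair

/-- **the general archimedean half ⇒ the general `gru_shape`** ([GelbartRogawski1991, Prop. 3.1.1] for `G₁ = U(T_V ⊗ T_W)(𝐀_F)`, every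
quadratic `E/F`, all symmetric invertible `T_V, T_W` over `F`, in the record form `SplittingDatum.CompatibleSplitting`): the splitting
character from `exists_isUnitary_isSplittingCharExt_one`, the finite half from `nonempty_finLocalFamily`, assembled by GR-2's
`compatibleSplitting_of_inputs`. [cite: GelbartRogawski1991, §3.1 Proposition 3.1.1 p. 455 L1–3; Kudla1994, Thm 3.1] -/
theorem symmetricCompatibleSplitting_of_archHalf
    (harch : ∀ (F : Type) [Field F] [NumberField F] (E : Type) [Field E] [NumberField E] [Algebra F E]
      [Algebra.IsQuadraticExtension F E] (c : E ≃ₐ[F] E) {δ : E} (hcδ : c δ = -δ) (hδ : δ ≠ 0) {d : F}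
      (hd : δ * δ = algebraMap F E d) {N M n : ℕ} (e : Fin N × Fin M ≃ Fin n)
      (TV : Matrix (Fin N) (Fin N) F) (hV : TV.IsSymm) (hVd : IsUnit TV.det)
      (TW : Matrix (Fin M) (Fin M) F) (hW : TW.IsSymm) (hWd : IsUnit TW.det)
      (χ : HeckeCharacter E), χ.IsUnitary → IsSplittingCharExt F E 1 χ →
      ∃ sa, IsArchHalf F E c hcδ hδ hd e TV hV hVd TW hW hWd χ sa) :
    Prop311.SymmetricCompatibleSplitting := by
  intro F _ _ E _ _ _ _ c δ hcδ hδ d hd N M n e TV hV hVd TW hW hWd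
  -- `have` before `obtain` (the datum's telescope is large)
  have hχex := exists_isUnitary_isSplittingCharExt_one F E
  obtain ⟨χ, hχu, hχ⟩ := hχex
  exact compatibleSplitting_of_inputs F E c hcδ hδ hd e TV hV hVd TW hW hWd χ
    (fun 𝔪 => nonempty_finLocalFamily F E c hcδ hδ hd e TV hV hVd TW hW hWd χ hχ 𝔪)
    (harch F E c hcδ hδ hd e TV hV hVd TW hW hWd χ hχu hχ)

end GRConstructionGen

namespace Prop311

/-- **[GelbartRogawski1991, Proposition 3.1.1] AS PRINTED, for EVERY quadratic extension of number fields, FROM THE GENERAL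
ARCHIMEDEAN HALF of the doubling construction** (the one input of the general-`(F, E, σ)` programme not yet in the tree).
[cite: GelbartRogawski1991, §3.1 Proposition 3.1.1, p. 455 L1–2; §1.1 p. 449 L26–32; §3.1 p. 454 L17–42] -/
theorem prop311AsPrinted_of_archHalf
    (harch : ∀ (F : Type) [Field F] [NumberField F] (E : Type) [Field E] [NumberField E] [Algebra F E]
      [Algebra.IsQuadraticExtension F E] (c : E ≃ₐ[F] E) {δ : E} (hcδ : c δ = -δ) (hδ : δ ≠ 0) {d : F}
      (hd : δ * δ = algebraMap F E d) {N M n : ℕ} (e : Fin N × Fin M ≃ Fin n)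
      (TV : Matrix (Fin N) (Fin N) F) (hV : TV.IsSymm) (hVd : IsUnit TV.det)
      (TW : Matrix (Fin M) (Fin M) F) (hW : TW.IsSymm) (hWd : IsUnit TW.det)
      (χ : HeckeCharacter E), χ.IsUnitary → IsSplittingCharExt F E 1 χ →
      ∃ sa, GRConstructionGen.IsArchHalf F E c hcδ hδ hd e TV hV hVd TW hW hWd χ sa) :
    Prop311AsPrinted :=
  prop311AsPrinted_of_symmetricCompatibleSplitting (GRConstructionGen.symmetricCompatibleSplitting_of_archHalf harch)

end Prop311

/-! ## Appendix (GR-1 g94, on GR-2 g126's ask): the DIAGONAL form — the archimedean half only for diagonal hermitian data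

The general archimedean half under construction (GR-2: sign frames per diagonal entry at the real places, as at CM) is for DIAGONAL
`T_V = diag dV`, `T_W = diag dW`; `Prop311AsPrinted` needs no more, through `Prop311.DiagonalCompatibleSplitting`
(`prop311AsPrinted_of_diagonalCompatibleSplitting`, the J9 route of `Prop311AsPrintedOfRecord`). -/

namespace GRConstructionGen

open UnitaryDualPair

/-- **the archimedean half for DIAGONAL data ⇒ the record for diagonal dual-pair data** (`Prop311.DiagonalCompatibleSplitting`):
as `symmetricCompatibleSplitting_of_archHalf`, at `TV := diagonal dV`, `TW := diagonal dW` (`dVᵢ, dWⱼ ≠ 0`).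
[cite: GelbartRogawski1991, §3.1 Proposition 3.1.1 p. 455 L1–3; Kudla1994, Thm 3.1] -/
theorem diagonalCompatibleSplitting_of_diagonalArchHalf
    (harch : ∀ (F : Type) [Field F] [NumberField F] (E : Type) [Field E] [NumberField E] [Algebra F E]
      [Algebra.IsQuadraticExtension F E] (c : E ≃ₐ[F] E) {δ : E} (hcδ : c δ = -δ) (hδ : δ ≠ 0) {d : F}
      (hd : δ * δ = algebraMap F E d) {N M n : ℕ} (e : Fin N × Fin M ≃ Fin n)
      (dV : Fin N → F) (hdV0 : ∀ i, dV i ≠ 0) (dW : Fin M → F) (hdW0 : ∀ j, dW j ≠ 0)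
      (χ : HeckeCharacter E), χ.IsUnitary → IsSplittingCharExt F E 1 χ →
      ∃ sa, IsArchHalf F E c hcδ hδ hd e (Matrix.diagonal dV) (Matrix.isSymm_diagonal dV)
        (Prop311.isUnit_det_diagonal_of_ne_zero dV hdV0) (Matrix.diagonal dW) (Matrix.isSymm_diagonal dW)
        (Prop311.isUnit_det_diagonal_of_ne_zero dW hdW0) χ sa) :
    Prop311.DiagonalCompatibleSplitting := by
  intro F _ _ E _ _ _ _ c δ hcδ hδ d hd N M n e dV hdV0 dW hdW0
  -- `have` before `obtain` (the datum's telescope is large)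
  have hχex := exists_isUnitary_isSplittingCharExt_one F E
  obtain ⟨χ, hχu, hχ⟩ := hχex
  exact compatibleSplitting_of_inputs F E c hcδ hδ hd e (Matrix.diagonal dV) (Matrix.isSymm_diagonal dV)
    (Prop311.isUnit_det_diagonal_of_ne_zero dV hdV0) (Matrix.diagonal dW) (Matrix.isSymm_diagonal dW)
    (Prop311.isUnit_det_diagonal_of_ne_zero dW hdW0) χ
    (fun 𝔪 => nonempty_finLocalFamily F E c hcδ hδ hd e (Matrix.diagonal dV) (Matrix.isSymm_diagonal dV)
      (Prop311.isUnit_det_diagonal_of_ne_zero dV hdV0) (Matrix.diagonal dW) (Matrix.isSymm_diagonal dW)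
      (Prop311.isUnit_det_diagonal_of_ne_zero dW hdW0) χ hχ 𝔪)
    (harch F E c hcδ hδ hd e dV hdV0 dW hdW0 χ hχu hχ)

end GRConstructionGen

namespace Prop311

/-- **[GelbartRogawski1991, Proposition 3.1.1] AS PRINTED, for EVERY quadratic extension of number fields, FROM THE ARCHIMEDEAN HALF
FOR DIAGONAL HERMITIAN DATA** `T_V = diag dV`, `T_W = diag dW` (all that the printed statement needs: its `(V, Φ)` is diagonalised by
an orthogonal basis, `Prop311AsPrintedOfRecord`). [cite: GelbartRogawski1991, §3.1 Proposition 3.1.1, p. 455 L1–2; §1.1 p. 449 L26–32; §3.1 p. 454 L17–42] -/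
theorem prop311AsPrinted_of_diagonalArchHalf
    (harch : ∀ (F : Type) [Field F] [NumberField F] (E : Type) [Field E] [NumberField E] [Algebra F E]
      [Algebra.IsQuadraticExtension F E] (c : E ≃ₐ[F] E) {δ : E} (hcδ : c δ = -δ) (hδ : δ ≠ 0) {d : F}
      (hd : δ * δ = algebraMap F E d) {N M n : ℕ} (e : Fin N × Fin M ≃ Fin n)
      (dV : Fin N → F) (hdV0 : ∀ i, dV i ≠ 0) (dW : Fin M → F) (hdW0 : ∀ j, dW j ≠ 0)
      (χ : HeckeCharacter E), χ.IsUnitary → IsSplittingCharExt F E 1 χ →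
      ∃ sa, GRConstructionGen.IsArchHalf F E c hcδ hδ hd e (Matrix.diagonal dV) (Matrix.isSymm_diagonal dV)
        (isUnit_det_diagonal_of_ne_zero dV hdV0) (Matrix.diagonal dW) (Matrix.isSymm_diagonal dW)
        (isUnit_det_diagonal_of_ne_zero dW hdW0) χ sa) :
    Prop311AsPrinted :=
  prop311AsPrinted_of_diagonalCompatibleSplitting (GRConstructionGen.diagonalCompatibleSplitting_of_diagonalArchHalf harch)

end Prop311

end Literature.NumberTheory.GelbartRogawski1991

end
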